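import Summits.Schanuel.Schanuel.Theorems.SoloInformedX193Pieces
import Summits.Schanuel.Schanuel.Theorems.SoloInformedDilatedFactor

/-!
# X193 kernel, file F11a-1 — the twist polynomial of a piece is a piece

Solo-informed Schanuel programme (toy line X), kernel of Roy's small value programme
[Roy2010, Thm 2.6 (i)]: the algebra behind the twist law (TW) of the SERVICE IDENTITY
(`SoloInformedX193Service`, `SoloServiceData.twistLaw`) for the concrete service data
`soloX_pieces ξ R` (`SoloInformedX193Pieces`).

For a piece `P` (normalised irreducible `P ∈ ℤ[T]`, `deg P = g ≥ 1`, `P ≠ T`) and columns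
`k, j ≥ 1`, the DILATION is `dil P k j = j^g P(kT/j) = Σ a_i k^i j^(g-i) T^i` and the TWIST
POLYNOMIAL is `twistPoly P k j = normalize (primPart (dil P k j))`.  This file proves:

* `soloX_coeff_dil'`, `soloX_map_dil`, `soloX_aeval_dil`, `soloX_supNorm_dil_le`: coefficients,
  the identity `dil P k j = j^g · P(kT/j)` in `ℚ[T]`, the value `dil P k j (jz) = j^g P(kz)`, and
  the height bound `‖dil P k j‖_∞ ≤ max(k, j)^g ‖P‖_∞`;
* `soloX_twistPoly_map_associated`: in `ℚ[T]` the twist polynomial is a unit multiple of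
  `P(kT/j)` — the CHARACTERISATION used for all the algebraic conjuncts of (TW), together with
  `soloX_piece_eq_of_associated_map` (two pieces associated over `ℚ` are equal, by Gauss's
  lemma `IsPrimitive.Int.dvd_iff_map_cast_dvd_map_cast` and normalisation);
* `soloX_twistPoly_mem`: **the twist polynomial of a piece is a piece** — irreducible by
  Gauss's lemma (`IsPrimitive.Int.irreducible_iff_irreducible_map_cast`; `P(kT/j)` is the image
  of the irreducible `P` under the automorphism `algEquivCMulXAddC (k/j) 0` of `ℚ[T]`),
  normalised by construction, of degree `g`, and `≠ T` because a piece has non-zero constant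
  coefficient (`soloX_piece_coeff_zero_ne_zero`: else `T ∣ P`, forcing `P = T`).

Small tools: on `ℤ[T]` normalisation is `±`-identity (`soloX_normalize_eq_or`), so it preserves
`‖·‖_∞` and absolute values of complex values.  Reused, not restated: `soloDF_*`
(`SoloInformedDilatedFactor`: the `P ∘ (aT)` toolkit) and Mathlib's `scaleRoots` /
`algEquivCMulXAddC` / Gauss-lemma API.  Unconditional; no sorries.  The six conjuncts of
(TW) for `soloX_pieces` are file F11a-2 (`SoloInformedX193Twists`).
-/

namespace Summit.Schanuel.Schanuel.Theorems

open Polynomial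

/-! ### Normalisation on `ℤ[X]` is `±`-identity -/

/-- On `ℤ[X]`, `normalize q = q` or `normalize q = -q`. -/
theorem soloX_normalize_eq_or (q : ℤ[X]) : normalize q = q ∨ normalize q = -q := by
  rw [normalize_apply, Polynomial.coe_normUnit]
  rcases Int.units_eq_one_or (normUnit q.leadingCoeff) with h | h
  · left; rw [h, Units.val_one, C_1, mul_one]
  · right; rw [h, Units.val_neg, Units.val_one, C_neg, C_1, mul_neg, mul_one]

/-- The sup norm is invariant under normalisation on `ℤ[X]`. -/
theorem soloX_supNorm_normalize (q : ℤ[X]) : (normalize q).supNorm = q.supNorm := by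
  rcases soloX_normalize_eq_or q with h | h
  · rw [h]
  · rw [h, supNorm_eq_iSup, supNorm_eq_iSup]; simp only [coeff_neg, norm_neg]

/-- Absolute values of complex values are invariant under normalisation on `ℤ[X]`. -/
theorem soloX_norm_aeval_normalize (q : ℤ[X]) (z : ℂ) :
    ‖aeval z (normalize q)‖ = ‖aeval z q‖ := by
  rcases soloX_normalize_eq_or q with h | h
  · rw [h]
  · rw [h, map_neg, norm_neg]

/-! ### Two facts about pieces -/

/-- A piece has non-zero constant coefficient: it is irreducible, normalised and `≠ X`. -/
theorem soloX_piece_coeff_zero_ne_zero (P : soloX_pieceSet) : (P : ℤ[X]).coeff 0 ≠ 0 := by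
  intro h0
  obtain ⟨c, hc⟩ := X_dvd_iff.mpr h0
  rcases (soloX_piece_irreducible P).isUnit_or_isUnit hc with hX | hcU
  · exact Polynomial.not_isUnit_X hX
  · obtain ⟨u, hu⟩ := hcU
    have h1 : normalize (P : ℤ[X]) = normalize X :=
      normalize_eq_normalize ⟨↑u⁻¹, by rw [hc, ← hu, mul_assoc, Units.mul_inv, mul_one]⟩
        ⟨c, hc⟩
    rw [soloX_piece_normalize, monic_X.normalize_eq_self] at h1
    exact soloX_piece_ne_X P h1

/-- Two pieces whose images in `ℚ[X]` are associated are equal (Gauss's lemma: primitive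
integer polynomials dividing each other over `ℚ` divide each other over `ℤ`). -/
theorem soloX_piece_eq_of_associated_map {P Q : soloX_pieceSet}
    (h : Associated ((P : ℤ[X]).map (Int.castRingHom ℚ))
      ((Q : ℤ[X]).map (Int.castRingHom ℚ))) : P = Q := by
  apply soloX_piece_ext
  have hPQ : (P : ℤ[X]) ∣ Q :=
    (IsPrimitive.Int.dvd_iff_map_cast_dvd_map_cast _ _ (soloX_piece_isPrimitive P)).mpr h.dvd
  have hQP : (Q : ℤ[X]) ∣ P :=
    (IsPrimitive.Int.dvd_iff_map_cast_dvd_map_cast _ _ (soloX_piece_isPrimitive Q)).mpr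
      h.symm.dvd
  rw [← soloX_piece_normalize P, ← soloX_piece_normalize Q]
  exact normalize_eq_normalize hPQ hQP

/-! ### The dilation `dil P k j = j^g P(kT/j)` -/

/-- Coefficients of the dilation: `(dil P k j)_i = a_i k^i j^(g-i)` (`k ≠ 0`, `g = deg P`). -/
theorem soloX_coeff_dil' (P : ℤ[X]) {k : ℕ} (hk : k ≠ 0) (j i : ℕ) :
    (soloX_dil P k j).coeff i = P.coeff i * (k : ℤ) ^ i * (j : ℤ) ^ (P.natDegree - i) := by
  rw [soloX_coeff_dil, comp_C_mul_X_coeff,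
    soloDF_natDegree_comp_C_mul_X P (show (k : ℤ) ≠ 0 by exact_mod_cast hk)]

/-- The dilation has the degree of `P` (`k ≠ 0`). -/
theorem soloX_natDegree_dil' (P : ℤ[X]) {k : ℕ} (hk : k ≠ 0) (j : ℕ) :
    (soloX_dil P k j).natDegree = P.natDegree := by
  rw [soloX_natDegree_dil, soloDF_natDegree_comp_C_mul_X P (show (k : ℤ) ≠ 0 by exact_mod_cast hk)]

/-- The dilation of a non-zero polynomial is non-zero (`k ≠ 0`). -/
theorem soloX_dil_ne_zero {P : ℤ[X]} (hP : P ≠ 0) {k : ℕ} (hk : k ≠ 0) (j : ℕ) :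
    soloX_dil P k j ≠ 0 := by
  intro h
  have h1 := congrArg leadingCoeff h
  rw [soloX_dil_def, leadingCoeff_scaleRoots, leadingCoeff_zero, leadingCoeff_eq_zero] at h1
  exact soloDF_comp_C_mul_X_ne_zero hP (show (k : ℤ) ≠ 0 by exact_mod_cast hk) h1

/-- Over `ℚ`: `dil P k j = j^g · P(kT/j)`. -/
theorem soloX_map_dil (P : ℤ[X]) {k j : ℕ} (hk : k ≠ 0) (hj : j ≠ 0) :
    (soloX_dil P k j).map (Int.castRingHom ℚ) =
      C ((j : ℚ) ^ P.natDegree) * (P.map (Int.castRingHom ℚ)).comp (C ((k : ℚ) / j) * X) := by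
  ext i
  rw [coeff_map, soloX_coeff_dil' P hk, coeff_C_mul, comp_C_mul_X_coeff, coeff_map]
  by_cases hi : i ≤ P.natDegree
  · have hj' : (j : ℚ) ≠ 0 := by exact_mod_cast hj
    simp only [eq_intCast, Int.cast_mul, Int.cast_pow, Int.cast_natCast]
    rw [pow_sub₀ _ hj' hi, div_pow]
    field_simp
  · rw [coeff_eq_zero_of_natDegree_lt (not_le.mp hi)]
    simp

/-- Values of the dilation: `dil P k j (j z) = j^g · P(k z)` (`k ≠ 0`). -/
theorem soloX_aeval_dil (P : ℤ[X]) {k : ℕ} (hk : k ≠ 0) (j : ℕ) (z : ℂ) :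
    aeval ((j : ℂ) * z) (soloX_dil P k j) = (j : ℂ) ^ P.natDegree * aeval ((k : ℂ) * z) P := by
  rw [soloX_dil_def, aeval_def, show ((j : ℂ) * z) = algebraMap ℤ ℂ (j : ℤ) * z by simp,
    scaleRoots_eval₂_mul, ← aeval_def, soloDF_aeval_comp_C_mul_X,
    soloDF_natDegree_comp_C_mul_X P (show (k : ℤ) ≠ 0 by exact_mod_cast hk)]
  simp

/-- Height of the dilation: `‖dil P k j‖_∞ ≤ max(k, j)^g ‖P‖_∞` (`k, j ≥ 1`). -/
theorem soloX_supNorm_dil_le (P : ℤ[X]) {k j : ℕ} (hk : 1 ≤ k) (hj : 1 ≤ j) :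
    (soloX_dil P k j).supNorm ≤ ((max k j : ℕ) : ℝ) ^ P.natDegree * P.supNorm := by
  obtain ⟨i, hi⟩ := exists_eq_supNorm (soloX_dil P k j)
  rw [hi, soloX_coeff_dil' P (by omega) j i]
  have hkm : (k : ℝ) ≤ ((max k j : ℕ) : ℝ) := by exact_mod_cast le_max_left k j
  have hjm : (j : ℝ) ≤ ((max k j : ℕ) : ℝ) := by exact_mod_cast le_max_right k j
  by_cases hP : i ≤ P.natDegree
  · calc ‖P.coeff i * (k : ℤ) ^ i * (j : ℤ) ^ (P.natDegree - i)‖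
          = ‖P.coeff i‖ * (k : ℝ) ^ i * (j : ℝ) ^ (P.natDegree - i) := by
            rw [norm_mul, norm_mul, norm_pow, norm_pow, Int.norm_natCast, Int.norm_natCast]
      _ ≤ ‖P.coeff i‖ * ((max k j : ℕ) : ℝ) ^ i * ((max k j : ℕ) : ℝ) ^ (P.natDegree - i) := by
            gcongr
      _ = ‖P.coeff i‖ * ((max k j : ℕ) : ℝ) ^ P.natDegree := by
            rw [mul_assoc, ← pow_add, Nat.add_sub_cancel' hP]
      _ ≤ P.supNorm * ((max k j : ℕ) : ℝ) ^ P.natDegree := by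
            gcongr; exact P.le_supNorm i
      _ = ((max k j : ℕ) : ℝ) ^ P.natDegree * P.supNorm := mul_comm _ _
  · rw [coeff_eq_zero_of_natDegree_lt (not_le.mp hP), zero_mul, zero_mul, norm_zero]
    exact mul_nonneg (pow_nonneg (Nat.cast_nonneg _) _) (supNorm_nonneg _)

/-! ### Scaling `X ↦ cX` on `ℚ[X]` -/

/-- `q ↦ q(cT)` (`c ≠ 0`) preserves irreducibility in `ℚ[X]` (it is an algebra automorphism). -/
theorem soloX_irreducible_comp_C_mul_X {q : ℚ[X]} (hq : Irreducible q) {c : ℚ} (hc : c ≠ 0) :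
    Irreducible (q.comp (C c * X)) := by
  letI : Invertible c := invertibleOfNonzero hc
  have h := (MulEquiv.irreducible_iff (algEquivCMulXAddC c (0 : ℚ))).mpr hq
  rwa [algEquivCMulXAddC_apply, ← comp_eq_aeval, C_0, add_zero] at h

/-- Composition on the right preserves association. -/
theorem soloX_associated_comp {a b : ℚ[X]} (h : Associated a b) (r : ℚ[X]) :
    Associated (a.comp r) (b.comp r) := by
  simpa only [coe_compRingHom_apply] using h.map (compRingHom r)

/-- Two scalings compose: `q(aT)(bT) = q(abT)`. -/
theorem soloX_comp_C_mul_X_comp (q : ℚ[X]) (a b : ℚ) :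
    (q.comp (C a * X)).comp (C b * X) = q.comp (C (a * b) * X) := by
  rw [comp_assoc, mul_comp, C_comp, X_comp, ← mul_assoc, ← C_mul]

/-! ### The twist polynomial of a piece is a piece -/

/-- The twist polynomial is associated to the primitive part of the dilation. -/
theorem soloX_twistPoly_associated (P : ℤ[X]) (k j : ℕ) :
    Associated (soloX_twistPoly P k j) (soloX_dil P k j).primPart := by
  rw [soloX_twistPoly_def]; exact normalize_associated _

/-- The twist polynomial is primitive. -/
theorem soloX_twistPoly_isPrimitive (P : ℤ[X]) (k j : ℕ) :
    (soloX_twistPoly P k j).IsPrimitive :=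
  Polynomial.isPrimitive_of_dvd (isPrimitive_primPart _) (soloX_twistPoly_associated P k j).dvd

/-- The twist polynomial has the degree of `P` (`k ≠ 0`). -/
theorem soloX_natDegree_twistPoly (P : ℤ[X]) {k : ℕ} (hk : k ≠ 0) (j : ℕ) :
    (soloX_twistPoly P k j).natDegree = P.natDegree := by
  rw [← soloX_natDegree_dil' P hk j, ← natDegree_primPart (soloX_dil P k j)]
  exact natDegree_eq_of_degree_eq
    (degree_eq_degree_of_associated (soloX_twistPoly_associated P k j))

/-- Over `ℚ`, the twist polynomial is associated to `P(kT/j)` (`P ≠ 0`, `k, j ≠ 0`). -/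
theorem soloX_twistPoly_map_associated {P : ℤ[X]} (hP : P ≠ 0) {k j : ℕ} (hk : k ≠ 0)
    (hj : j ≠ 0) :
    Associated ((soloX_twistPoly P k j).map (Int.castRingHom ℚ))
      ((P.map (Int.castRingHom ℚ)).comp (C ((k : ℚ) / j) * X)) := by
  have hD : soloX_dil P k j ≠ 0 := soloX_dil_ne_zero hP hk j
  have h1 : Associated ((soloX_twistPoly P k j).map (Int.castRingHom ℚ))
      ((soloX_dil P k j).primPart.map (Int.castRingHom ℚ)) := by
    simpa only [coe_mapRingHom] using
      (soloX_twistPoly_associated P k j).map (mapRingHom (Int.castRingHom ℚ))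
  have hc : IsUnit (C ((Int.castRingHom ℚ) (soloX_dil P k j).content)) := by
    rw [eq_intCast]
    exact isUnit_C.mpr (IsUnit.mk0 _ (by exact_mod_cast mt content_eq_zero_iff.mp hD))
  have h2 : Associated ((soloX_dil P k j).primPart.map (Int.castRingHom ℚ))
      ((soloX_dil P k j).map (Int.castRingHom ℚ)) := by
    conv_rhs => rw [(soloX_dil P k j).eq_C_content_mul_primPart, Polynomial.map_mul, map_C]
    exact (associated_unit_mul_left _ _ hc).symm
  have hu : IsUnit (C ((j : ℚ) ^ P.natDegree)) :=
    isUnit_C.mpr (IsUnit.mk0 _ (pow_ne_zero _ (by exact_mod_cast hj)))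
  have h3 : Associated ((soloX_dil P k j).map (Int.castRingHom ℚ))
      ((P.map (Int.castRingHom ℚ)).comp (C ((k : ℚ) / j) * X)) := by
    rw [soloX_map_dil P hk hj]
    exact associated_unit_mul_left _ _ hu
  exact h1.trans (h2.trans h3)

/-- **The twist polynomial of a piece is a piece** (`k, j ≥ 1`): irreducible by Gauss's lemma
(over `ℚ` it is a unit multiple of `P(kT/j)`, the image of the irreducible `P` under an
automorphism of `ℚ[T]`), normalised by construction, of degree `deg P ≥ 1`, and `≠ X` since
its constant coefficient `a_0 j^g / content` is non-zero. -/
theorem soloX_twistPoly_mem (P : soloX_pieceSet) {k j : ℕ} (hk : 1 ≤ k) (hj : 1 ≤ j) :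
    soloX_twistPoly (P : ℤ[X]) k j ∈ soloX_pieceSet := by
  have hk0 : k ≠ 0 := by omega
  have hj0 : j ≠ 0 := by omega
  refine ⟨?_, soloX_normalize_twistPoly _ k j, ?_, ?_⟩
  · have hQ : Irreducible (((P : ℤ[X]).map (Int.castRingHom ℚ)).comp (C ((k : ℚ) / j) * X)) :=
      soloX_irreducible_comp_C_mul_X
        ((IsPrimitive.Int.irreducible_iff_irreducible_map_cast (soloX_piece_isPrimitive P)).mp
          (soloX_piece_irreducible P))
        (div_ne_zero (by exact_mod_cast hk0) (by exact_mod_cast hj0))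
    exact (IsPrimitive.Int.irreducible_iff_irreducible_map_cast
      (soloX_twistPoly_isPrimitive _ k j)).mpr
      ((soloX_twistPoly_map_associated (soloX_piece_ne_zero P) hk0 hj0).symm.irreducible hQ)
  · rw [soloX_natDegree_twistPoly _ hk0]; exact soloX_piece_natDegree_pos P
  · intro hX
    have h1 : X ∣ soloX_dil (P : ℤ[X]) k j :=
      (dvd_of_eq hX.symm).trans ((soloX_twistPoly_associated _ k j).dvd.trans (primPart_dvd _))
    rw [X_dvd_iff, soloX_coeff_dil' _ hk0, pow_zero, mul_one, Nat.sub_zero] at h1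
    exact mul_ne_zero (soloX_piece_coeff_zero_ne_zero P)
      (pow_ne_zero _ (by exact_mod_cast hj0)) h1

end Summit.Schanuel.Schanuel.Theorems
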